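/-
Copyright (c) 2026. All rights reserved.
Released under Apache 2.0 license as described in the file LICENSE.
Authors: abc-iut cell — seat abc-iut-f-100 (F fact-proving wave, tranche 100; FACT-LIST row F-0129).
Proof-only companion to `HolomorphicCores.lean` ([AbsTopIII] Prop 2.5 (b)); no new definitions.
-/
import Literature.AnabelianGeometry.AbsoluteAnabelian.ParallelogramsRelationsClosureRefuted
import Literature.AnabelianGeometry.AbsoluteAnabelian.ParallelogramsPlanarOrientationSign
import HarnessLib

/-!
# [AbsTopIII] Prop 2.5 (b): `StrictlyParallel` is a RELATION — structure, model instances and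
# non-instances, universal closure REFUTED (FACT-LIST F-0129; proof-only)

S. Mochizuki, *Topics in absolute anabelian geometry III: global reconstruction algorithms*, J. Math. Sci.
Univ. Tokyo 22 (2015) [MochizukiAbsTopIII2015], Prop. 2.5, kurims manuscript p. 56:

> (b) […] Define two line segments `L, L′` of `U` to be *strictly parallel* if there exist
> non-intersecting sides `S, S′` of a parallelogram `∈ 𝒬(U)` such that `S ⊆ L`, `S′ ⊆ L′`. Then one
> constructs the pairs `(L, L′)` of *parallel* line segments by observing that `L, L′` are parallel if
> and only if `L` is equivalent to `L′` relative to the equivalence relation on line segments generated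
> by the relation of inclusion and the relation of being strictly parallel.

The abc-iut cell's FACT-LIST row **F-0129** `Parallelograms.StrictlyParallel` (`HolomorphicCores.lean`,
abc-iut-L4-t14) names one of the RELATIONS produced by the algorithm of Prop. 2.5 on an abstract pair
`(U, 𝒬)` — vocabulary (a parametrised predicate, binders `𝒬`, `L L' : Set U`), like its siblings
`Parallel` / `StrictlyCoOriented` / `LocalAdd` (F-0125…F-0127, `ParallelogramsRelationsClosureRefuted.lean`,
abc-iut-f-099) and `StrictlyCollinear` (F-0128, `HolomorphicCoresStrictlyCollinear.lean`).  A relation has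
no truth value "as a fact"; this file records the kernel events that classify the row (cell rule R5:
admissible AT NAMED INSTANCES only):

* STRUCTURE on abstract data (any `U`, `𝒬`): strict parallelism is symmetric and monotone, the two
  witnessing sides are themselves strictly parallel, strictly parallel line segments are PARALLEL
  (`StrictlyParallel.parallel` — the printed generation in (b)), and the relation is empty for `𝒬 = ∅`.
* THE PRINTED INPUT DATA `U ⊆ ℂ` open, any `𝒮(U) ⊆ 𝒬 ⊆ 𝒫(U)`: the opposite edges of every member of
  `𝒬` ARE strictly parallel (`strictlyParallel_opposite_edges`, `…'`; cf. the landed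
  `strictlyParallel_chords`, abc-iut-L6-t15); strictly parallel line segments lie on two distinct parallel
  lines, so they are DISJOINT (`StrictlyParallel.inter_eq_empty`; directions are real-proportional by the
  landed `StrictlyParallel.exists_sub_eq_mul`), hence distinct, and no line segment is strictly parallel to
  itself or to a line segment it meets (`not_strictlyParallel_self`, `not_strictlyParallel_of_inter_nonempty`).
* UNIVERSAL CLOSURE REFUTED, witnessed at the printed model `(ℂ, 𝒮(ℂ))` by a genuine line segment, not
  at a junk instance: `not_forall_lineSegments_strictlyParallel` (the unit edge `[0, 1]`, a line segment of
  `(ℂ, 𝒮(ℂ))`, is not strictly parallel to itself), hence `not_forall_strictlyParallel`.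

So the row carries the FACT-LIST label «universal-closure REFUTED; instance forms PROVED» and may be bound
by a consumer only through the named instance theorems.  Refereed pre-IUT material, elementary plane
geometry; a refuted closure says the row is a relation on data, not that anything in print is false;
nothing here bears on the disputed [IUTchIII] Cor. 3.12 or takes a side.
-/

namespace Literature.AnabelianGeometry.AbsoluteAnabelian

open _root_.Complex _root_.Set

noncomputable section

namespace Parallelograms

/-! ### Structure of the relation on abstract data `(U, 𝒬)` -/

section Abstract

variable {U : Type*} {𝒬 : Set (Set U)}

/-- A side of `Q ∈ 𝒬` is a line segment (by definition). [cite: MochizukiAbsTopIII2015, Proposition 2.5 (b) p.56] -/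
theorem IsSide.isLineSegment {Q S : Set U} (hS : IsSide 𝒬 Q S) : IsLineSegment 𝒬 S :=
  hS.2.1

/-- Strict parallelism is symmetric (swap the two sides). [cite: MochizukiAbsTopIII2015, Proposition 2.5 (b) p.56] -/
theorem StrictlyParallel.symm {L L' : Set U} (h : StrictlyParallel 𝒬 L L') : StrictlyParallel 𝒬 L' L := by
  obtain ⟨Q, hQ, S, S', hS, hS', hSS', hSL, hS'L'⟩ := h
  exact ⟨Q, hQ, S', S, hS', hS, by rwa [inter_comm], hS'L', hSL⟩

/-- Strict parallelism is symmetric (iff form). [cite: MochizukiAbsTopIII2015, Proposition 2.5 (b) p.56] -/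
theorem strictlyParallel_comm {L L' : Set U} : StrictlyParallel 𝒬 L L' ↔ StrictlyParallel 𝒬 L' L :=
  ⟨StrictlyParallel.symm, StrictlyParallel.symm⟩

/-- Strict parallelism is monotone in both arguments (the same two sides witness it for larger sets).
[cite: MochizukiAbsTopIII2015, Proposition 2.5 (b) p.56] -/
theorem StrictlyParallel.mono {L L' M M' : Set U} (h : StrictlyParallel 𝒬 L L') (hL : L ⊆ M)
    (hL' : L' ⊆ M') : StrictlyParallel 𝒬 M M' := by
  obtain ⟨Q, hQ, S, S', hS, hS', hSS', hSL, hS'L'⟩ := h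
  exact ⟨Q, hQ, S, S', hS, hS', hSS', hSL.trans hL, hS'L'.trans hL'⟩

/-- The two witnessing sides are themselves strictly parallel.
[cite: MochizukiAbsTopIII2015, Proposition 2.5 (b) p.56] -/
theorem strictlyParallel_of_sides {Q S S' : Set U} (hS : IsSide 𝒬 Q S) (hS' : IsSide 𝒬 Q S')
    (hSS' : S ∩ S' = ∅) : StrictlyParallel 𝒬 S S' :=
  ⟨Q, hS.1, S, S', hS, hS', hSS', Subset.rfl, Subset.rfl⟩

/-- **F-0129, the printed use of the relation (Prop 2.5 (b)): strictly parallel line segments are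
PARALLEL** (parallelism is the equivalence relation generated by inclusion and strict parallelism).
[cite: MochizukiAbsTopIII2015, Proposition 2.5 (b) p.56] -/
theorem StrictlyParallel.parallel {L L' : Set U} (hL : IsLineSegment 𝒬 L) (hL' : IsLineSegment 𝒬 L')
    (h : StrictlyParallel 𝒬 L L') : Parallel 𝒬 L L' :=
  ⟨hL, hL', Relation.EqvGen.rel _ _ ⟨hL, hL', Or.inr h⟩⟩

/-- **F-0129, dependence on `𝒬`:** for the empty collection no two sets are strictly parallel (there is
no parallelogram to take sides of). [cite: MochizukiAbsTopIII2015, Proposition 2.5 (b) p.56] -/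
theorem not_strictlyParallel_empty (L L' : Set U) : ¬ StrictlyParallel (∅ : Set (Set U)) L L' := by
  rintro ⟨Q, hQ, -⟩
  exact hQ

end Abstract

/-! ### The printed input data: `U ⊆ ℂ` open, `𝒮(U) ⊆ 𝒬 ⊆ 𝒫(U)` -/

section Planar

variable {U : Set ℂ} (hU : IsOpen U) {𝒬 : Set (Set U)}
  (h𝒬 : ∀ Q ∈ 𝒬, Subtype.val '' Q ∈ parallelogramsIn U)
  (h𝒮 : ∀ Q : Set U, Subtype.val '' Q ∈ squaresIn U → Q ∈ 𝒬)

include hU h𝒬 h𝒮 in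
/-- **F-0129, instance at the printed input data: opposite edges of a member of `𝒬` are strictly
parallel.** For `Q ∈ 𝒬` with `val '' Q = openParallelogram z v w` (non-degenerate, closure in `U`) the
edges `[z, z + v]` and `[z + w, z + w + v]` are non-intersecting sides of `Q`, hence strictly parallel line
segments of `(U, 𝒬)`. [cite: MochizukiAbsTopIII2015, Proposition 2.5 (b) p.56] -/
theorem strictlyParallel_opposite_edges {Q : Set U} (hQ : Q ∈ 𝒬) {z v w : ℂ}
    (hQe : Subtype.val '' Q = openParallelogram z v w) (h : LinearIndependent ℝ ![v, w])
    (hcl : closure (openParallelogram z v w) ⊆ U) :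
    StrictlyParallel 𝒬 (Subtype.val ⁻¹' segment ℝ z (z + v))
      (Subtype.val ⁻¹' segment ℝ (z + w) (z + w + v)) := by
  obtain ⟨A, hA⟩ := exists_homeomorph_frame z v w h
  have hbot : A '' (Icc 0 1 ×ℂ {(0 : ℝ)}) = segment ℝ z (z + v) := by
    rw [image_frame_Icc_const hA]; simp
  have htop : A '' (Icc 0 1 ×ℂ {(1 : ℝ)}) = segment ℝ (z + w) (z + w + v) := by
    rw [image_frame_Icc_const hA]; simp
  have hS : IsSide 𝒬 Q (Subtype.val ⁻¹' segment ℝ z (z + v)) :=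
    (isSide_iff_of_subset hU h𝒬 h𝒮 hQ hQe h hcl hA).2 ⟨_, Or.inl rfl, by rw [hbot]⟩
  have hS' : IsSide 𝒬 Q (Subtype.val ⁻¹' segment ℝ (z + w) (z + w + v)) :=
    (isSide_iff_of_subset hU h𝒬 h𝒮 hQ hQe h hcl hA).2 ⟨_, Or.inr (Or.inl rfl), by rw [htop]⟩
  refine strictlyParallel_of_sides hS hS' ?_
  rw [← hbot, ← htop, ← preimage_inter, ← image_inter A.injective, reProdIm_inter_reProdIm]
  have : (Icc (0 : ℝ) 1 ∩ Icc 0 1) ×ℂ ({(0 : ℝ)} ∩ {1}) = ∅ := by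
    ext p; simp [mem_reProdIm]
  rw [this, image_empty, preimage_empty]

include hU h𝒬 h𝒮 in
/-- **F-0129, instance at the printed input data**, the other pair: the edges `[z, z + w]` and
`[z + v, z + v + w]` of `Q` are strictly parallel. [cite: MochizukiAbsTopIII2015, Proposition 2.5 (b) p.56] -/
theorem strictlyParallel_opposite_edges' {Q : Set U} (hQ : Q ∈ 𝒬) {z v w : ℂ}
    (hQe : Subtype.val '' Q = openParallelogram z v w) (h : LinearIndependent ℝ ![v, w])
    (hcl : closure (openParallelogram z v w) ⊆ U) :
    StrictlyParallel 𝒬 (Subtype.val ⁻¹' segment ℝ z (z + w))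
      (Subtype.val ⁻¹' segment ℝ (z + v) (z + v + w)) := by
  rw [← openParallelogram_comm] at hQe hcl
  exact strictlyParallel_opposite_edges hU h𝒬 h𝒮 hQ hQe (LinearIndependent.pair_symm_iff.mp h) hcl

/-- Points of a segment `[a, b]` containing the non-degenerate segment `[p, p + u]` lie on the line
`p + ℝ u`. (Auxiliary.) [cite: MochizukiAbsTopIII2015, Proposition 2.5 (proof) pp.55–57] -/
theorem exists_eq_add_mul_of_segment_subset {p u a b x : ℂ} (hu : u ≠ 0)
    (h : segment ℝ p (p + u) ⊆ segment ℝ a b) (hx : x ∈ segment ℝ a b) :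
    ∃ θ : ℝ, x = p + (θ : ℂ) * u := by
  have hpq : p ≠ p + u := fun h' => hu (by linear_combination -h')
  obtain ⟨σ, τ, ha, hb⟩ := exists_lineMap_eq_of_mem_segment (h (left_mem_segment ℝ _ _))
    (h (right_mem_segment ℝ _ _)) hpq
  rw [segment_eq_image_lineMap] at hx
  obtain ⟨μ, -, rfl⟩ := hx
  refine ⟨σ + μ * (τ - σ), ?_⟩
  rw [lineMap_apply_complex, ha, hb, lineMap_apply_complex, lineMap_apply_complex]
  push_cast
  ring

include hU h𝒬 h𝒮 in
/-- **F-0129 at the printed input data: strictly parallel line segments are DISJOINT.**  If line segments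
`M ⊇ S`, `M' ⊇ S'` of `(U, 𝒬)` contain non-intersecting sides `S, S'` of some `Q ∈ 𝒬` — opposite edges of
the parallelogram `val '' Q = openParallelogram z v w` — then `M`, `M'` lie on the two distinct parallel
lines through these edges, so `M ∩ M' = ∅`.  (Directions are real-proportional:
`StrictlyParallel.exists_sub_eq_mul`.) [cite: MochizukiAbsTopIII2015, Proposition 2.5 (b) p.56] -/
theorem StrictlyParallel.inter_eq_empty {M M' : Set U} (hM : IsLineSegment 𝒬 M) (hM' : IsLineSegment 𝒬 M')
    (hMM' : StrictlyParallel 𝒬 M M') : M ∩ M' = ∅ := by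
  obtain ⟨a, b, -, hMe⟩ := hM.exists_eq_segment_of_subset hU h𝒬 h𝒮
  obtain ⟨a', b', -, hM'e⟩ := hM'.exists_eq_segment_of_subset hU h𝒬 h𝒮
  obtain ⟨Q, hQ, S, S', hS, hS', hSS', hSM, hS'M'⟩ := hMM'
  obtain ⟨z, v, w, hvw, hQe, hcl⟩ := h𝒬 Q hQ
  rw [hQe] at hcl
  obtain ⟨A, hA⟩ := exists_homeomorph_frame z v w hvw
  have hv : v ≠ 0 := by simpa using hvw.ne_zero 0
  have hw : w ≠ 0 := by simpa using hvw.ne_zero 1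
  obtain ⟨E, hE, rfl⟩ := (isSide_iff_of_subset hU h𝒬 h𝒮 hQ hQe hvw hcl hA).1 hS
  obtain ⟨E', hE', rfl⟩ := (isSide_iff_of_subset hU h𝒬 h𝒮 hQ hQe hvw hcl hA).1 hS'
  have hEU : ∀ {F : Set ℂ}, (F = Icc 0 1 ×ℂ {(0 : ℝ)} ∨ F = Icc 0 1 ×ℂ {(1 : ℝ)} ∨
      F = {(0 : ℝ)} ×ℂ Icc 0 1 ∨ F = {(1 : ℝ)} ×ℂ Icc 0 1) → A '' F ⊆ U := fun hF =>
    (image_mono (sq_edge_subset_boundary hF)).trans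
      ((closure_diff_openParallelogram_eq_image hvw hA).symm.le.trans (sdiff_subset.trans hcl))
  -- the two edges are disjoint, hence both horizontal or both vertical
  have hdisj : E ∩ E' = ∅ := by
    have := congrArg (fun T : Set U => Subtype.val '' T) hSS'
    simp only [image_empty] at this
    rw [image_inter Subtype.val_injective, image_val_preimage_val_of_subset (hEU hE),
      image_val_preimage_val_of_subset (hEU hE'), ← image_inter A.injective, image_eq_empty] at this
    exact this
  -- an edge inside a line segment `N = [c, d]`
  have hsub : ∀ {F : Set ℂ} {N : Set U} {c d : ℂ}, A '' F ⊆ U →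
      (Subtype.val ⁻¹' (A '' F) : Set U) ⊆ N → Subtype.val '' N = segment ℝ c d →
      A '' F ⊆ segment ℝ c d := by
    intro F N c d hFU hFN hN
    rw [← image_val_preimage_val_of_subset hFU, ← hN]
    exact image_mono hFN
  refine eq_empty_iff_forall_notMem.2 fun x hx => ?_
  have hxa : (x : ℂ) ∈ segment ℝ a b := hMe ▸ mem_image_of_mem _ hx.1
  have hxa' : (x : ℂ) ∈ segment ℝ a' b' := hM'e ▸ mem_image_of_mem _ hx.2
  rcases sq_edges_disjoint hE hE' hdisj with ⟨t, t', rfl, rfl⟩ | ⟨s, s', rfl, rfl⟩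
  · have h1 := hsub (hEU hE) hSM hMe
    have h2 := hsub (hEU hE') hS'M' hM'e
    rw [image_frame_Icc_const hA] at h1 h2
    obtain ⟨θ, hθ⟩ := exists_eq_add_mul_of_segment_subset hv h1 hxa
    obtain ⟨θ', hθ'⟩ := exists_eq_add_mul_of_segment_subset hv h2 hxa'
    have hli := (LinearIndependent.pair_iff.1 hvw) (θ - θ') (t - t') (by
      rw [Complex.real_smul, Complex.real_smul]; push_cast; linear_combination hθ' - hθ)
    have htt : t = t' := sub_eq_zero.1 hli.2
    subst htt
    rw [inter_self] at hdisj
    have hmem : (⟨0, t⟩ : ℂ) ∈ Icc (0 : ℝ) 1 ×ℂ ({t} : Set ℝ) := by simp [mem_reProdIm]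
    rw [hdisj] at hmem
    exact hmem
  · have h1 := hsub (hEU hE) hSM hMe
    have h2 := hsub (hEU hE') hS'M' hM'e
    rw [image_frame_const_Icc hA] at h1 h2
    obtain ⟨θ, hθ⟩ := exists_eq_add_mul_of_segment_subset hw h1 hxa
    obtain ⟨θ', hθ'⟩ := exists_eq_add_mul_of_segment_subset hw h2 hxa'
    have hli := (LinearIndependent.pair_iff.1 hvw) (s - s') (θ - θ') (by
      rw [Complex.real_smul, Complex.real_smul]; push_cast; linear_combination hθ' - hθ)
    have hss : s = s' := sub_eq_zero.1 hli.1
    subst hss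
    rw [inter_self] at hdisj
    have hmem : (⟨s, 0⟩ : ℂ) ∈ ({s} : Set ℝ) ×ℂ Icc (0 : ℝ) 1 := by simp [mem_reProdIm]
    rw [hdisj] at hmem
    exact hmem

include hU h𝒬 h𝒮 in
/-- **F-0129, non-instance at the printed input data:** line segments of `(U, 𝒬)` that MEET are not
strictly parallel. [cite: MochizukiAbsTopIII2015, Proposition 2.5 (b) p.56] -/
theorem not_strictlyParallel_of_inter_nonempty {M M' : Set U} (hM : IsLineSegment 𝒬 M)
    (hM' : IsLineSegment 𝒬 M') (h : (M ∩ M').Nonempty) : ¬ StrictlyParallel 𝒬 M M' := fun hMM' => by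
  rw [hMM'.inter_eq_empty hU h𝒬 h𝒮 hM hM'] at h
  exact Set.not_nonempty_empty h

include hU h𝒬 h𝒮 in
/-- **F-0129, non-instance at the printed input data:** no line segment of `(U, 𝒬)` is strictly parallel
to itself (strict parallelism is irreflexive on line segments; parallelism is reflexive).
[cite: MochizukiAbsTopIII2015, Proposition 2.5 (b) p.56] -/
theorem not_strictlyParallel_self {M : Set U} (hM : IsLineSegment 𝒬 M) : ¬ StrictlyParallel 𝒬 M M := by
  refine not_strictlyParallel_of_inter_nonempty hU h𝒬 h𝒮 hM hM ?_
  rw [inter_self]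
  obtain ⟨a, b, -, hMe⟩ := hM.exists_eq_segment_of_subset hU h𝒬 h𝒮
  have : (Subtype.val '' M).Nonempty := hMe ▸ ⟨a, left_mem_segment ℝ a b⟩
  exact this.of_image

include hU h𝒬 h𝒮 in
/-- **F-0129 at the printed input data:** strictly parallel line segments are distinct.
[cite: MochizukiAbsTopIII2015, Proposition 2.5 (b) p.56] -/
theorem StrictlyParallel.ne {M M' : Set U} (hM : IsLineSegment 𝒬 M) (hM' : IsLineSegment 𝒬 M')
    (hMM' : StrictlyParallel 𝒬 M M') : M ≠ M' := by
  rintro rfl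
  exact not_strictlyParallel_self hU h𝒬 h𝒮 hM hMM'

end Planar

/-! ### The universal closure of the row is false (witnessed at the model `(ℂ, 𝒮(ℂ))`) -/

section Closure

/-- **F-0129: the universal closure of `Parallelograms.StrictlyParallel` is FALSE — even restricted to LINE
SEGMENTS of the printed input data**: at `(ℂ, 𝒮(ℂ))` the unit edge `[0, 1]` is a line segment and is not
strictly parallel to itself (`not_strictlyParallel_self`).  The row is a relation (Prop 2.5 (b)), admissible
at named instances only; positive instances: `strictlyParallel_opposite_edges`, `strictlyParallel_chords`.
[cite: MochizukiAbsTopIII2015, Proposition 2.5 (b) p.56] -/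
theorem not_forall_lineSegments_strictlyParallel :
    ¬ ∀ (U : Type) (𝒬 : Set (Set U)) (L L' : Set U),
        Literature.AnabelianGeometry.AbsoluteAnabelian.Parallelograms.IsLineSegment 𝒬 L →
        Literature.AnabelianGeometry.AbsoluteAnabelian.Parallelograms.IsLineSegment 𝒬 L' →
        Literature.AnabelianGeometry.AbsoluteAnabelian.Parallelograms.StrictlyParallel 𝒬 L L' := by
  intro h
  have hL : IsLineSegment {Q : Set (univ : Set ℂ) | Subtype.val '' Q ∈ squaresIn univ}
      (Subtype.val ⁻¹' segment ℝ (0 : ℂ) 1) :=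
    isLineSegment_of_segment_subset isOpen_univ squares_hyps.1 squares_hyps.2 zero_ne_one (subset_univ _)
  exact not_strictlyParallel_self isOpen_univ squares_hyps.1 squares_hyps.2 hL (h _ _ _ _ hL hL)

/-- **F-0129: the universal closure of `Parallelograms.StrictlyParallel` is FALSE** (corollary; the bare
closure quantifies over every collection `𝒬`, e.g. the empty one, `not_strictlyParallel_empty`).
[cite: MochizukiAbsTopIII2015, Proposition 2.5 (b) p.56] -/
theorem not_forall_strictlyParallel :
    ¬ ∀ (U : Type) (𝒬 : Set (Set U)) (L L' : Set U),
        Literature.AnabelianGeometry.AbsoluteAnabelian.Parallelograms.StrictlyParallel 𝒬 L L' :=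
  fun h => not_forall_lineSegments_strictlyParallel fun U 𝒬 L L' _ _ => h U 𝒬 L L'

end Closure

end Parallelograms

end

end Literature.AnabelianGeometry.AbsoluteAnabelian
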